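import Summits.CriticalPhenomena.PercolationContinuityZ3.Theorems.Transplant.SkelFrmQuasiBParamsFaceCountsRangeA
import Summits.CriticalPhenomena.PercolationContinuityZ3.Theorems.Transplant.SkelFrmBParamsFaceCountsRangeA
import Summits.CriticalPhenomena.PercolationContinuityZ3.Theorems.Transplant.SkelFrmQuasiBParamsFaceRunA
import Summits.CriticalPhenomena.PercolationContinuityZ3.Theorems.Transplant.SkelFrmBParamsFaceRunA
import Summits.CriticalPhenomena.PercolationContinuityZ3.Theorems.Transplant.SkelFrmQuasiBChoiceNums
import Summits.CriticalPhenomena.PercolationContinuityZ3.Theorems.Transplant.SkelFrmBChoiceNums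
import Summits.CriticalPhenomena.PercolationContinuityZ3.Theorems.Transplant.SkelPhiFaceNumsYRun
import Summits.CriticalPhenomena.PercolationContinuityZ3.Theorems.Transplant.SkelNegBParamsFaceFloorsClrXA
import Summits.CriticalPhenomena.PercolationContinuityZ3.Theorems.Transplant.PlanarSkeletonFrmQuasiDefs
import Summits.CriticalPhenomena.PercolationContinuityZ3.Theorems.Transplant.PlanarSkeletonFrmDefs
import Summits.CriticalPhenomena.PercolationContinuityZ3.Theorems.Transplant.SkelPhiStepIDataNS
import Summits.CriticalPhenomena.PercolationContinuityZ3.Theorems.Transplant.SkelFrmQuasi1ChoiceDefs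
import Summits.CriticalPhenomena.PercolationContinuityZ3.Theorems.Transplant.SkelFrmQuasi1ParamsLBL
import Summits.CriticalPhenomena.PercolationContinuityZ3.Theorems.Transplant.SkelFrmQuasiBParamsFaceCountsA
import Summits.CriticalPhenomena.PercolationContinuityZ3.Theorems.Transplant.SkelFrmQuasiBParamsFaceUnits
import Summits.CriticalPhenomena.PercolationContinuityZ3.Theorems.Transplant.SkelFrmQuasiBParamsLF
import Summits.CriticalPhenomena.PercolationContinuityZ3.Theorems.Transplant.SkelFrmQuasiBParamsLFA
import HarnessLib
import Summits.CriticalPhenomena.PercolationContinuityZ3.Theorems.Transplant.SkelFrmBParamsFaceFloorsClrXA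
/-!
# GEN-Q PORT (WAVE-Q table v0.8 section 2, row G169, U-level L18; captain R-6/R-7 2026-08-27: carrier token swap `PlanarSkeletonFrmFrom ↦ PlanarSkeletonFrmQuasi`)
# of the tree module «Transplant/SkelFrmFromBParamsFaceFloorsClrXA» (sha256 ba930900cc82b08a…) onto the quasi-step carrier `PlanarSkeletonFrmQuasi` (p507026): «SkelFrmQuasiBParamsFaceFloorsClrXA»

HAND HUNK (L-FLOORMAP-1 ①⑥ / L-KitS-1 reader side; G017 «SkelFrmQuasiBChoiceNums», hp-8's KitSN): KS0.R'0→KS0.R'0N×1, KS0.R'0_eq→KS0.R'0N_eq×1, KS0.j₁0→KS0.j₁0N×1, KS0.T0→KS0.T0N×1 — the kit of record at window cost `KS.NQ Φ`.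

ORIGINAL TITLE: (F) VALUE LAYER, N2 twin (hp-8 g42, 2026-08-23; F-DISCHARGE-MAP-N2 G18 x-face seed clearances; (Δ2)/(R-22)): `port_frm.py` text of N1 `SkelNegBParamsFaceFloorsClrXA`

builds on p205010 (kernel theorem, internal audit signed; external expert review pending) — nothing in this file uses p205010; NOTHING is claimed about any open node
((N3-b), the end state).  Lane `prim-bschramm`, seat `prim-bschramm-stmt` (gen 33; GEN-Q column pen; tool = captain gen-1 g4's port_genq.py R-14 --cone + p3-g30's T1 patch).  Helper file (`--supports stmt-CriticalPhenomena-4575 --as helper`).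
PORT RULES (U-wave r1–r4 re-used, GEN-Q hunk classes of p3-g29 #6136): declaration order, names and proof texts are those of «SkelFrmFromBParamsFaceFloorsClrXA», byte-identical except
(i) the carrier token `PlanarSkeletonFrmFrom ↦ PlanarSkeletonFrmQuasi` in binders, `namespace`/`end` lines and qualified names (module names `SkelFrmFrom… ↦ SkelFrmQuasi…`
in imports of already-ported rows); (ii) `Φ.step ↦ Φ.qstep` with the called Steps lemma replaced by its `…Q`/`_q` twin and the cost `Φ.M` threaded (none in this file unless
listed below); (iii) `Φ.cyl_connected ↦ Φ.cyl_reach` readers (none unless listed); (iv) graph-ball radii / window floors ×`Φ.M` (none unless listed).  Carrier-free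
residents stay imported/exported from the original «SkelFrmBParamsFaceFloorsClrXA» exactly as in the FrmFrom port.  Docstrings and citations are the original's.

-/

noncomputable section

open scoped Classical

namespace Summit.CriticalPhenomena.PercolationContinuityZ3.Theorems.Transplant

namespace PlanarSkeletonFrmQuasi

namespace NegB

open Literature.Probability.Percolation Literature.Probability.LatticeModels SimpleGraph
open Literature.Probability.Percolation.KozmaNitzan.Cells (oth sgOf sgOf_sign)
open SkelConc (Consts)
open Skelφ (shearUnit shearUnit_pos xBoxLoA yBoxLoT yBoxHiT yBoxLoS crossOffX)
open Skelφ.StepI (DataN)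
open TwoAxis.Para (modulus)
open Neg

namespace KS

/-! ## §1 Generic arithmetic (chain-free) -/

section Arith

export PlanarSkeletonNeg.NegB.KS (clr_hclrX_of_zero)

export PlanarSkeletonNeg.NegB.KS (clr_yBoxT_range)

export PlanarSkeletonNeg.NegB.KS (clr_tan_alpha_of_room)

export PlanarSkeletonNeg.NegB.KS (clr_mul_sLo_ge)

export PlanarSkeletonNeg.NegB.KS (clr_tan_level_arith)

end Arith

/-! ## §2 Reading the origin at the (ζ′) tuple -/

section Origin

/-- The shear unit at the long data: `n_L ≤ U ≤ 11·n_L` (`|h_L| ≤ 10 n_L`). [folklore] -/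
theorem clr_shearUnit_bounds (κ : Consts) {V : Type} [DecidableEq V] [Countable V] {G : SimpleGraph V} [G.LocallyFinite] (Φ : PlanarSkeletonFrmQuasi G) (t : V) (p : unitInterval) (D : Skelφ.StepI.DataNS V) (g : ℕ) (f : ℕ) (hκ : (hL κ Φ t p D g f).natAbs ≤ 10 * nL κ Φ t p D g f) :
    (nL κ Φ t p D g f : ℤ) ≤ (shearUnit (nL κ Φ t p D g f) (hL κ Φ t p D g f) : ℤ) ∧
      (shearUnit (nL κ Φ t p D g f) (hL κ Φ t p D g f) : ℤ) ≤ 11 * (nL κ Φ t p D g f : ℤ) := by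
  unfold Skelφ.shearUnit
  constructor
  · push_cast; linarith [abs_nonneg (hL κ Φ t p D g f)]
  · have : (((hL κ Φ t p D g f).natAbs : ℕ) : ℤ) ≤ ((10 * nL κ Φ t p D g f : ℕ) : ℤ) := by exact_mod_cast hκ
    push_cast at this ⊢; linarith

export PlanarSkeletonNeg.NegB.KS (clr_abs_fun_of_reading)

/-- **The ordinate reading controls `Λ₁`**: `|F1cA y| ≤ c·u₁` gives `|Λ₁(y)| ≤ (c+1)·m` (`F1cA = (2u₁Λ₁ + m)/(2m)`). [folklore] -/
theorem clr_abs_Λ₁of_le (κ : Consts) {V : Type} [DecidableEq V] [Countable V] {G : SimpleGraph V} [G.LocallyFinite] (Φ : PlanarSkeletonFrmQuasi G) (t : V) (p : unitInterval) (D : Skelφ.StepI.DataNS V) (g : ℕ) (f : ℕ) (hN : EqNumL κ Φ t p D g f) (y : Site 2) {c : ℤ} (hc : 0 ≤ c) (h : |F1cA κ Φ t p D g f y| ≤ c * u₁A κ Φ t p D g f) :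
    |Λ₁of κ Φ t p D g f y| ≤ (c + 1) * modulus (nL κ Φ t p D g f) (hL κ Φ t p D g f) (vL κ Φ t p D g f) (vβL κ Φ t p D g f) := by
  obtain ⟨hn1, hℓ1⟩ := one_le_of_eqNumL κ Φ t p D g f hN
  exact clr_abs_fun_of_reading (Skelφ.NegPrm.modulus_vβOf_pos hn1 hℓ1 _ _) (units_eqA κ Φ t p D g f).2.2.2.2.2 hc (F1cA_eq κ Φ t p D g f y) h

/-- **The abscissa reading controls `Λ₀`**: `|FcA y| ≤ c·u₀` gives `|Λ₀(y)| ≤ (c+1)·m`. [folklore] -/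
theorem clr_abs_Λ₀of_le (κ : Consts) {V : Type} [DecidableEq V] [Countable V] {G : SimpleGraph V} [G.LocallyFinite] (Φ : PlanarSkeletonFrmQuasi G) (t : V) (p : unitInterval) (D : Skelφ.StepI.DataNS V) (g : ℕ) (f : ℕ) (hN : EqNumL κ Φ t p D g f) (y : Site 2) {c : ℤ} (hc : 0 ≤ c) (h : |FcA κ Φ t p D g f y| ≤ c * u₀A κ Φ t p D g f) :
    |Λ₀of κ Φ t p D g f y| ≤ (c + 1) * modulus (nL κ Φ t p D g f) (hL κ Φ t p D g f) (vL κ Φ t p D g f) (vβL κ Φ t p D g f) := by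
  obtain ⟨hn1, hℓ1⟩ := one_le_of_eqNumL κ Φ t p D g f hN
  exact clr_abs_fun_of_reading (Skelφ.NegPrm.modulus_vβOf_pos hn1 hℓ1 _ _) (units_eqA κ Φ t p D g f).2.2.2.2.1 hc (FcA_eq κ Φ t p D g f y) h

/-- **The abscissa from the two functionals**: `m·y 0 = n_L·Λ₀(y) + v_L·Λ₁(y)`. [folklore] -/
theorem clr_modulus_mul_zero (κ : Consts) {V : Type} [DecidableEq V] [Countable V] {G : SimpleGraph V} [G.LocallyFinite] (Φ : PlanarSkeletonFrmQuasi G) (t : V) (p : unitInterval) (D : Skelφ.StepI.DataNS V) (g : ℕ) (f : ℕ) (y : Site 2) :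
    modulus (nL κ Φ t p D g f) (hL κ Φ t p D g f) (vL κ Φ t p D g f) (vβL κ Φ t p D g f) * y 0 =
      (nL κ Φ t p D g f : ℤ) * Λ₀of κ Φ t p D g f y + vL κ Φ t p D g f * Λ₁of κ Φ t p D g f y := by
  unfold Λ₀of Λ₁of vβL TwoAxis.Para.modulus; ring

/-- **The cross shift moves `Λ₁` by less than `n_L`**: `|Λ₁(yTX0 yL σT) − Λ₁(yL)| ≤ n_L` (`n_L·⌊σT h_L v_L/n_L⌋ − σT h_L v_L ∈ (−n_L, 0]`). [folklore] -/
theorem clr_abs_Λ₁of_yTX0_sub (κ : Consts) {V : Type} [DecidableEq V] [Countable V] {G : SimpleGraph V} [G.LocallyFinite] (Φ : PlanarSkeletonFrmQuasi G) (t : V) (p : unitInterval) (D : Skelφ.StepI.DataNS V) (g : ℕ) (f : ℕ) (hN : EqNumL κ Φ t p D g f) (yL : Site 2) (σT : ℤ) :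
    |Λ₁of κ Φ t p D g f (yTX0 κ Φ t p D g f yL σT) - Λ₁of κ Φ t p D g f yL| ≤ (nL κ Φ t p D g f : ℤ) := by
  obtain ⟨hn1, -⟩ := one_le_of_eqNumL κ Φ t p D g f hN
  have hn0 : (0 : ℤ) < (nL κ Φ t p D g f : ℤ) := by exact_mod_cast hn1
  obtain ⟨f1, f2⟩ := PlanarSkeletonNeg.NegB.RootArith.floor_sandwich (x := σT * hL κ Φ t p D g f * vL κ Φ t p D g f) hn0
  unfold Λ₁of yTX0
  simp only [Pi.add_apply, Skelφ.pt_zero, Skelφ.pt_one]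
  rw [abs_le]
  constructor
  · nlinarith
  · nlinarith

/-- **The tangential origin's level is the cross-shifted origin's `Λ₁`**: `n_L·yT 1 − h_L·yT 0 = Λ₁(yTX0 yL σT)` for `yT = yL + crossOffX … σ σT Nr`
(the `(Nr+1)` whole strides `(n_L, h_L)` have level `0`). [folklore] -/
theorem clr_lvl_yT_eq (κ : Consts) {V : Type} [DecidableEq V] [Countable V] {G : SimpleGraph V} [G.LocallyFinite] (Φ : PlanarSkeletonFrmQuasi G) (t : V) (p : unitInterval) (D : Skelφ.StepI.DataNS V) (g : ℕ) (f : ℕ) (yL : Site 2) (σ σT : ℤ) (Nr : ℕ) :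
    (nL κ Φ t p D g f : ℤ) * (yL + crossOffX (nL κ Φ t p D g f) (hL κ Φ t p D g f) (vL κ Φ t p D g f) σ σT Nr) 1 -
        hL κ Φ t p D g f * (yL + crossOffX (nL κ Φ t p D g f) (hL κ Φ t p D g f) (vL κ Φ t p D g f) σ σT Nr) 0 =
      Λ₁of κ Φ t p D g f (yTX0 κ Φ t p D g f yL σT) := by
  rw [crossOffX_eq]
  unfold Λ₁of
  simp only [Pi.add_apply, Skelφ.pt_zero, Skelφ.pt_one]
  ring

/-- **The tangential origin's level is within `7m + n_L` of the contact's** when `|F1cA yL| ≤ 6u₁`. [folklore] -/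
theorem clr_abs_lvl_yT_le (κ : Consts) {V : Type} [DecidableEq V] [Countable V] {G : SimpleGraph V} [G.LocallyFinite] (Φ : PlanarSkeletonFrmQuasi G) (t : V) (p : unitInterval) (D : Skelφ.StepI.DataNS V) (g : ℕ) (f : ℕ) (hN : EqNumL κ Φ t p D g f) (yL : Site 2) (he1 : |F1cA κ Φ t p D g f yL| ≤ 6 * u₁A κ Φ t p D g f) (σ σT : ℤ) (Nr : ℕ) :
    |(nL κ Φ t p D g f : ℤ) * (yL + crossOffX (nL κ Φ t p D g f) (hL κ Φ t p D g f) (vL κ Φ t p D g f) σ σT Nr) 1 -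
        hL κ Φ t p D g f * (yL + crossOffX (nL κ Φ t p D g f) (hL κ Φ t p D g f) (vL κ Φ t p D g f) σ σT Nr) 0| ≤
      7 * modulus (nL κ Φ t p D g f) (hL κ Φ t p D g f) (vL κ Φ t p D g f) (vβL κ Φ t p D g f) + (nL κ Φ t p D g f : ℤ) := by
  rw [clr_lvl_yT_eq]
  have h1 := clr_abs_Λ₁of_le κ Φ t p D g f hN yL (by norm_num : (0:ℤ) ≤ 6) he1
  have h2 := clr_abs_Λ₁of_yTX0_sub κ Φ t p D g f hN yL σT
  have h3 := abs_le.1 h1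
  have h4 := abs_le.1 h2
  rw [abs_le]; constructor <;> linarith

/-- **The cross-shifted origin is within `15·n_L` of the contact in abscissa** when `|FcA(yTX0 yL σT)| ≤ 6u₀`, `|F1cA yL| ≤ 6u₁` (and `ℓ_L ≥ 2`).
[folklore] -/
theorem clr_abs_yTX0_zero_le (κ : Consts) {V : Type} [DecidableEq V] [Countable V] {G : SimpleGraph V} [G.LocallyFinite] (Φ : PlanarSkeletonFrmQuasi G) (t : V) (p : unitInterval) (D : Skelφ.StepI.DataNS V) (g : ℕ) (f : ℕ) (hN : EqNumL κ Φ t p D g f) (hℓ2 : 2 ≤ ℓL κ Φ t p D g f) (yL : Site 2) (σT : ℤ)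
    (he0 : |FcA κ Φ t p D g f (yTX0 κ Φ t p D g f yL σT)| ≤ 6 * u₀A κ Φ t p D g f) (he1 : |F1cA κ Φ t p D g f yL| ≤ 6 * u₁A κ Φ t p D g f) :
    |yTX0 κ Φ t p D g f yL σT 0| ≤ 15 * (nL κ Φ t p D g f : ℤ) := by
  obtain ⟨hn1, hℓ1⟩ := one_le_of_eqNumL κ Φ t p D g f hN
  have hn0 : (0 : ℤ) < (nL κ Φ t p D g f : ℤ) := by exact_mod_cast hn1
  obtain ⟨hm1, -⟩ := Skelφ.NegPrm.modulus_vβOf hn1 (hL κ Φ t p D g f) (ℓL κ Φ t p D g f) (vL κ Φ t p D g f)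
  have e : Skelφ.NegPrm.vβOf (nL κ Φ t p D g f) (hL κ Φ t p D g f) (ℓL κ Φ t p D g f) (vL κ Φ t p D g f) = vβL κ Φ t p D g f := rfl
  rw [e] at hm1
  have hv := hN.v_le
  have h0 := abs_le.1 (clr_abs_Λ₀of_le κ Φ t p D g f hN (yTX0 κ Φ t p D g f yL σT) (by norm_num : (0:ℤ) ≤ 6) he0)
  have h1 := abs_le.1 (clr_abs_Λ₁of_le κ Φ t p D g f hN yL (by norm_num : (0:ℤ) ≤ 6) he1)
  have h2 := abs_le.1 (clr_abs_Λ₁of_yTX0_sub κ Φ t p D g f hN yL σT)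
  have key := clr_modulus_mul_zero κ Φ t p D g f (yTX0 κ Φ t p D g f yL σT)
  set m := modulus (nL κ Φ t p D g f) (hL κ Φ t p D g f) (vL κ Φ t p D g f) (vβL κ Φ t p D g f)
  set n : ℤ := (nL κ Φ t p D g f : ℤ)
  set v := vL κ Φ t p D g f
  set L0 := Λ₀of κ Φ t p D g f (yTX0 κ Φ t p D g f yL σT)
  set L1 := Λ₁of κ Φ t p D g f (yTX0 κ Φ t p D g f yL σT)
  set y0 := yTX0 κ Φ t p D g f yL σT 0
  have hℓ' : (2 : ℤ) ≤ (ℓL κ Φ t p D g f : ℤ) := by exact_mod_cast hℓ2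
  have hnm : n ≤ m := by nlinarith
  have hm0 : 0 < m := by linarith
  have hL1 : |L1| ≤ 8 * m := by rw [abs_le]; constructor <;> linarith [h1.1, h1.2, h2.1, h2.2]
  have hL0 : |L0| ≤ 7 * m := abs_le.2 ⟨h0.1, h0.2⟩
  have hvL : |v * L1| ≤ n * (8 * m) := by rw [abs_mul]; exact mul_le_mul hv hL1 (abs_nonneg _) hn0.le
  have hnL : |n * L0| ≤ n * (7 * m) := by rw [abs_mul, abs_of_pos hn0]; exact mul_le_mul_of_nonneg_left hL0 hn0.le
  have hsum : |m * y0| ≤ 15 * n * m := by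
    rw [key]
    calc |n * L0 + v * L1| ≤ |n * L0| + |v * L1| := abs_add_le _ _
      _ ≤ n * (7 * m) + n * (8 * m) := add_le_add hnL hvL
      _ = 15 * n * m := by ring
  rw [abs_mul, abs_of_pos hm0] at hsum
  have : m * |y0| ≤ m * (15 * n) := by linarith
  exact le_of_mul_le_mul_left this hm0

end Origin

/-! ## §3 The two G-clr fields at the (ζ′) tuple -/

section Fields

/-- **THE ALONG COUNT IS AT LEAST `200·Kq − 8`**: the along target is `≥ 5r₀ + 1 − E − 6u₀ = (200·Kq − 6)u₀ + 1 − E` ahead of the cross-shifted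
origin and the run ends within one stride of it (`NrX_spec`). [folklore] -/
theorem clr_NrX_lb (κ : Consts) {V : Type} [DecidableEq V] [Countable V] {G : SimpleGraph V} [G.LocallyFinite] (Φ : PlanarSkeletonFrmQuasi G) (t : V) (p : unitInterval) (D : Skelφ.StepI.DataNS V) (g : ℕ) (f : ℕ) (P : PCells2T) (hP : P.toPCells2 = fcellsA κ Φ t p D g f) (hN : EqNumL κ Φ t p D g f) (x : Site 2) (du : MDir) (hd : du.1 = 0) (z : Site 2) {j E : ℕ} (hj : j < P.K)
    (hlev1 : P.faceL 0 j - E ≤ P.lev du x z)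
    (hlev2 : P.lev du x z ≤ P.faceL 0 j + E) (hEu : (E : ℤ) ≤ u₀A κ Φ t p D g f)
    (yL : Site 2) (σT : ℤ) (he0 : |FcA κ Φ t p D g f (yTX0 κ Φ t p D g f yL σT)| ≤ 6 * u₀A κ Φ t p D g f) :
    200 * (Neg.Kq κ : ℤ) ≤ (NrX κ Φ t p D g f P yL σT x du z : ℤ) + 8 := by
  obtain ⟨a1, -⟩ := along_target_bounds κ Φ t p D g f P hP x du hd z hj hlev1 hlev2 yL σT he0
  have hu : 1 ≤ u₀A κ Φ t p D g f := (units_eqA κ Φ t p D g f).2.2.2.2.1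
  obtain ⟨hX, -⟩ := NrX_range κ Φ t p D g f P hP hN x du hd z hj hlev1 hlev2 yL σT he0 (by linarith)
  obtain ⟨hf, -⟩ := NrX_spec κ Φ t p D g f P hN yL σT x du z hX
  rw [FcA_crossOffX κ Φ t p D g f hN] at hf
  have hr : (P.r 0 : ℤ) = 40 * (Neg.Kq κ : ℤ) * u₀A κ Φ t p D g f := by rw [(cells_of_hP κ Φ t p D g f P hP).1 0]; exact (units_eqA κ Φ t p D g f).2.2.1
  have hσ : sgOf du = 1 ∨ sgOf du = -1 := sgOf_sign du
  set u := u₀A κ Φ t p D g f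
  set Q : ℤ := (Neg.Kq κ : ℤ)
  set N : ℤ := (NrX κ Φ t p D g f P yL σT x du z : ℤ)
  set T := T0X P x du z
  set F := FcA κ Φ t p D g f (yTX0 κ Φ t p D g f yL σT)
  obtain ⟨hf1, hf2⟩ := abs_le.1 hf
  -- `u·(N+1) ≥ σ·(T − F) − u ≥ 200Qu + 1 − E − 7u ≥ (200Q − 8)u + 1`
  have key : (200 * Q - 8) * u + 1 ≤ u * (N + 1) := by
    rcases hσ with h | h <;> rw [h] at hf1 hf2 a1 <;> nlinarith
  by_contra hc
  push Not at hc
  have h1 : N + 9 - 200 * Q ≤ 0 := by linarith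
  have h2 : u * (N + 9 - 200 * Q) ≤ 0 := mul_nonpos_of_nonneg_of_nonpos (by linarith) h1
  nlinarith

-- GEN-Q (R-2, captain 2026-08-27): `PlanarSkeletonFrmFrom.NegB.KS.hclr_XA` is not in the used cone of the node top — not ported.

/-- `M_u + 2 ≤ R'0` for the (S0) kit (`R'0 = j₁0 + reach0 + 1`, `reach0 ≥ KCmax = 11·(Dsh + M_u + 1)`; N1's `Mu_add_two_le_RA'` for the apron kit). [folklore] -/
theorem Mu_add_two_le_R'0 (κ : Consts) {V : Type} [DecidableEq V] [Countable V] {G : SimpleGraph V} [G.LocallyFinite] (Φ : PlanarSkeletonFrmQuasi G) (t : V) (p : unitInterval)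
    (D : Skelφ.StepI.DataNS V) (mk : ℕ) : Mu D + 2 ≤ KS0.R'0N κ Φ (KS.NQ Φ) t p D mk := by
  rw [(KS0.R'0N_eq κ Φ (KS.NQ Φ) t p D mk).1]
  -- GEN-Q hand hunk: `reach0N = N(T0N+1) + N·da + N·KCmax ≥ KCmax` needs `1 ≤ N` (`KS.thirteen_le_NQ`)
  have h1 : Mu D + 2 ≤ KS.KCmax t D mk := by unfold KS.KCmax; nlinarith [Nat.zero_le (KS.Dsh t D mk)]
  have h2 : KS.KCmax t D mk ≤ KS0.reach0N (KS.NQ Φ) t D mk := by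
    have hN := KS.thirteen_le_NQ Φ
    have h3 : KS.KCmax t D mk ≤ KS.NQ Φ * KS.KCmax t D mk := Nat.le_mul_of_pos_left _ (by omega)
    unfold KS0.reach0N; omega
  omega

-- GEN-Q (R-2, captain 2026-08-27): `PlanarSkeletonFrmFrom.NegB.KS.hclr₃_XA` is not in the used cone of the node top — not ported.

end Fields

end KS

end NegB

end PlanarSkeletonFrmQuasi

end Summit.CriticalPhenomena.PercolationContinuityZ3.Theorems.Transplant

end
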